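import Mathlib.Analysis.SpecialFunctions.Trigonometric.Chebyshev.Orthogonality
import Literature.Analysis.Fourier.ChirpEulerMaclaurin

/-!
# YM-DAG node N19 (= NE7 proper) — FIXED OBSERVABLES UNDER THE UNIFORM-MOMENT CURRENCY, I: cosine orthogonality and BESSEL on `[0,π]`,
# and the odd cosine series of the triangle wave `arccos ∘ cos`

Cell `pub-ymgap`, HUMAN RULING D-0062 (Track A) ∕ D-0149 (work-bound push), R141 (C) wider-strategy seat `pub-ymgap-dag-n19-e` (strategy s3 =
ALTERNATIVE CURRENCY), generation g24, module 1 (lineage module 85; part II = module 86 `…N19TriangleWaveSquareFunction`, part III = module 87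
`…N19FixedTestArcChains`).  Route `Summits/QuantumFields/YangMills/Theses/BalabanUVNodes.lean` rev 25, cluster item K3⁷ «SpineGivenEndpointR13SepCoPH»
(stmt-QuantumFields-20544); filed `--supports` that item `--as helper` (it proves no registered stub).  COUNT-NEUTRAL: [folklore] real analysis over
Mathlib (Chebyshev `measureT` orthogonality `integral_eval_T_real_mul_eval_T_real_measureT_of_ne` ∕ `integral_T_real_mul_self_measureT_of_ne_zero` +
`integral_measureT_eq_integral_cos` + `T_real_cos`; `arccos_cos` ∕ `cos_arccos`) + the tree's `Literature.Analysis.Fourier.hasSum_cos_div_sq`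
(`ChirpEulerMaclaurin`: Mathlib's Bernoulli–Fourier identity `hasSum_one_div_nat_pow_mul_cos` at `k = 1`) BY IMPORT;
no scheme object, no Theses import; NOT a discharge claim.

WHY.  Module 83 (`…N19TargetFixedTestNotSummable`, p603144) exhibited ONE fixed Lipschitz observable with NON-summable expectation increments under the
WINDOW currency at geometric remainders; for the UNIFORM-MOMENT currency the only lower-bound family in the tree is the half-scale Chebyshev-arc chain of
modules 78∕79 (p597739 ∕ p599277), whose bounded-Lipschitz increments are not summable because the TESTS vary with the level.  This lineage segment
(modules 85–88) shows that along every such arc chain EVERY FIXED Lipschitz observable has ABSOLUTELY summable increments: after `x = cos θ` the level-`n`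
alternating arc functional is `−(1∕n)∫_0^π F′(θ)(arccos(cos nθ) − π∕2)dθ` (`F = G∘cos·sin`), the triangle wave expands in ODD harmonics `cos(lnθ)∕l²`,
and Bessel's inequality for the cosine coefficients of the bounded function `F′` makes `Σ_n (1∕n)|c_{ln}(F′)|` finite, uniformly in the test.
THIS FILE supplies the two Fourier inputs.  §1 `∫_0^π cos(nθ)cos(mθ)dθ = (π∕2)δ_{nm}` (`n ≥ 1`; transported from Mathlib's Chebyshev `measureT`).
§2 BESSEL BY HAND: for measurable `|f| ≤ M`, `Σ_{m<N} (∫_0^π f cos((m+1)·))² ≤ (π∕2)∫_0^π f² ≤ (π²∕2)M²` (expand `0 ≤ ∫(f − (2∕π)Σ c_m cos((m+1)·))²`).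
§3 ★ THE ODD COSINE SERIES OF THE TRIANGLE WAVE: `Σ_i cos((2i+1)u)∕(2i+1)² = π²∕8 − (π∕4)·arccos(cos u)` for EVERY real `u` (Mathlib's `k = 1`
Bernoulli identity — the tree's `hasSum_cos_div_sq` — at `x = u₀∕2π` and `2x`, `u₀ = arccos(cos u) ∈ [0,π]`, odd part = full − even; the fold `u ↦ u₀` costs nothing because `cos((2i+1)u) =
T_{2i+1}(cos u)`).

HONEST FRAMING (binding).  Elementary and [folklore]; no law, no scheme object; NO consumer in the DAG today (a structural statement about the seat's own
currencies); nothing of Bałaban's instantiated; NE7 NOT PRINTED, NOT proved; N19 NOT discharged; count-neutral.  One finite `T⁴` programme at fixed `ε`;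
nothing continuum ∕ `ℝ⁴` ∕ OS ∕ mass-gap ∕ Clay.  0 `def` ∕ 0 `sorry`.
-/

noncomputable section

open Real Finset MeasureTheory

namespace Summit.QuantumFields.YangMills.Theorems.BalabanUVNodesN19TriangleWaveBessel

/-! ## §1 Cosine orthogonality on `[0, π]` (transported from Mathlib's Chebyshev `measureT`) [folklore] -/

/-- `∫_0^π cos(nθ)cos(mθ)dθ = 0` for natural `n ≠ m` (Mathlib's `T_n ⊥ T_m` in `measureT`, moved to `[0,π]` by `x = cos θ`). [folklore] -/
theorem integral_cos_nat_mul_cos_nat_mul_of_ne {n m : ℕ} (h : n ≠ m) :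
    ∫ θ in (0 : ℝ)..π, Real.cos (n * θ) * Real.cos (m * θ) = 0 := by
  have h1 := Polynomial.Chebyshev.integral_eval_T_real_mul_eval_T_real_measureT_of_ne h
  rw [Polynomial.Chebyshev.integral_measureT_eq_integral_cos
    (f := fun x => (Polynomial.Chebyshev.T ℝ n).eval x * (Polynomial.Chebyshev.T ℝ m).eval x)] at h1
  simpa only [Polynomial.Chebyshev.T_real_cos, Int.cast_natCast] using h1

/-- `∫_0^π cos²(nθ)dθ = π∕2` for `n ≥ 1`. [folklore] -/
theorem integral_cos_nat_mul_sq {n : ℕ} (hn : n ≠ 0) :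
    ∫ θ in (0 : ℝ)..π, Real.cos (n * θ) * Real.cos (n * θ) = π / 2 := by
  have h1 := Polynomial.Chebyshev.integral_T_real_mul_self_measureT_of_ne_zero hn
  rw [Polynomial.Chebyshev.integral_measureT_eq_integral_cos
    (f := fun x => (Polynomial.Chebyshev.T ℝ n).eval x * (Polynomial.Chebyshev.T ℝ n).eval x)] at h1
  simpa only [Polynomial.Chebyshev.T_real_cos, Int.cast_natCast] using h1

/-- The orthogonality relations in one line: `∫_0^π cos(nθ)cos(mθ)dθ = (π∕2)·[n = m]` for `n ≥ 1`. [folklore] -/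
theorem integral_cos_nat_mul_cos_nat_mul (n m : ℕ) (hn : n ≠ 0) :
    ∫ θ in (0 : ℝ)..π, Real.cos (n * θ) * Real.cos (m * θ) = if n = m then π / 2 else 0 := by
  split_ifs with h
  · subst h; exact integral_cos_nat_mul_sq hn
  · exact integral_cos_nat_mul_cos_nat_mul_of_ne h

/-! ## §2 Bessel's inequality for the cosines on `[0, π]`, by hand [folklore] -/

/-- A bounded measurable function is interval integrable. [bookkeeping] -/
theorem intervalIntegrable_of_bounded {f : ℝ → ℝ} {M : ℝ} (hf : Measurable f) (hb : ∀ θ, |f θ| ≤ M) (a b : ℝ) :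
    IntervalIntegrable f volume a b := by
  refine (intervalIntegrable_iff).2 (Measure.integrableOn_of_bounded (M := M) ?_ hf.aestronglyMeasurable ?_)
  · exact measure_Ioc_lt_top.ne
  · exact Filter.Eventually.of_forall fun θ => by rw [Real.norm_eq_abs]; exact hb θ

/-- The cosine orthogonality of §1 at the shifted frequencies `m+1, m'+1`. [bookkeeping] -/
theorem integral_cos_succ_mul_cos_succ (m m' : ℕ) :
    ∫ θ in (0 : ℝ)..π, Real.cos (((m : ℝ) + 1) * θ) * Real.cos (((m' : ℝ) + 1) * θ) = if m = m' then π / 2 else 0 := by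
  have h := integral_cos_nat_mul_cos_nat_mul (m + 1) (m' + 1) (Nat.succ_ne_zero m)
  push_cast at h
  rw [h]

/-- **BESSEL FOR THE COSINES ON `[0,π]`** (finite form): with `c_m = ∫_0^π f(θ)cos((m+1)θ)dθ`,
`Σ_{m<N} c_m² ≤ (π∕2)∫_0^π f²` — expand `0 ≤ ∫(f − (2∕π)Σ_{m<N} c_m cos((m+1)·))²` with §1. [folklore] -/
theorem sum_sq_cosCoeff_le {f : ℝ → ℝ} {M : ℝ} (hf : Measurable f) (hb : ∀ θ, |f θ| ≤ M) (N : ℕ) :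
    ∑ m ∈ Finset.range N, (∫ θ in (0 : ℝ)..π, f θ * Real.cos (((m : ℝ) + 1) * θ)) ^ 2 ≤
      π / 2 * ∫ θ in (0 : ℝ)..π, f θ ^ 2 := by
  set c : ℕ → ℝ := fun m => ∫ θ in (0 : ℝ)..π, f θ * Real.cos (((m : ℝ) + 1) * θ) with hc
  set S : ℝ → ℝ := fun θ => ∑ m ∈ Finset.range N, (2 / π * c m) * Real.cos (((m : ℝ) + 1) * θ) with hS
  have hcos_cont : ∀ m : ℕ, Continuous fun θ : ℝ => Real.cos (((m : ℝ) + 1) * θ) := fun m =>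
    Real.continuous_cos.comp (continuous_const.mul continuous_id)
  have hSc : Continuous S := by
    simp only [hS]
    exact continuous_finsetSum _ fun m _ => continuous_const.mul (hcos_cont m)
  have hfi : IntervalIntegrable f volume 0 π := intervalIntegrable_of_bounded hf hb 0 π
  have hf2i : IntervalIntegrable (fun θ => f θ ^ 2) volume 0 π := by
    refine intervalIntegrable_of_bounded (M := M ^ 2) (hf.pow_const 2) (fun θ => ?_) 0 π
    rw [abs_pow]
    exact pow_le_pow_left₀ (abs_nonneg _) (hb θ) 2
  have hfSi : IntervalIntegrable (fun θ => f θ * S θ) volume 0 π := hfi.mul_continuousOn hSc.continuousOn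
  have hSSi : IntervalIntegrable (fun θ => S θ * S θ) volume 0 π := (hSc.mul hSc).intervalIntegrable _ _
  have hcosi : ∀ m : ℕ, IntervalIntegrable (fun θ => f θ * Real.cos (((m : ℝ) + 1) * θ)) volume 0 π := fun m =>
    hfi.mul_continuousOn (hcos_cont m).continuousOn
  -- (a) `∫ f S = (2∕π) Σ c_m²`
  have ha : ∫ θ in (0 : ℝ)..π, f θ * S θ = 2 / π * ∑ m ∈ Finset.range N, c m ^ 2 := by
    have e : ∀ θ, f θ * S θ = ∑ m ∈ Finset.range N, (2 / π * c m) * (f θ * Real.cos (((m : ℝ) + 1) * θ)) := by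
      intro θ; simp only [hS, Finset.mul_sum]; exact Finset.sum_congr rfl fun m _ => by ring
    simp_rw [e]
    rw [intervalIntegral.integral_finsetSum fun m _ => (hcosi m).const_mul _, Finset.mul_sum]
    refine Finset.sum_congr rfl fun m _ => ?_
    rw [intervalIntegral.integral_const_mul]
    simp only [hc]
    ring
  -- (b) `∫ S² = (2∕π) Σ c_m²`
  have hb' : ∫ θ in (0 : ℝ)..π, S θ * S θ = 2 / π * ∑ m ∈ Finset.range N, c m ^ 2 := by
    have e : ∀ θ, S θ * S θ = ∑ m ∈ Finset.range N, ∑ m' ∈ Finset.range N,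
        (2 / π * c m) * (2 / π * c m') * (Real.cos (((m : ℝ) + 1) * θ) * Real.cos (((m' : ℝ) + 1) * θ)) := by
      intro θ; simp only [hS, Finset.sum_mul_sum]
      exact Finset.sum_congr rfl fun m _ => Finset.sum_congr rfl fun m' _ => by ring
    simp_rw [e]
    have hterm : ∀ m m' : ℕ, Continuous fun θ : ℝ =>
        (2 / π * c m) * (2 / π * c m') * (Real.cos (((m : ℝ) + 1) * θ) * Real.cos (((m' : ℝ) + 1) * θ)) :=
      fun m m' => continuous_const.mul ((hcos_cont m).mul (hcos_cont m'))
    rw [intervalIntegral.integral_finsetSum fun m _ =>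
      (continuous_finsetSum _ fun m' _ => hterm m m').intervalIntegrable _ _]
    have inner : ∀ m ∈ Finset.range N, ∫ θ in (0 : ℝ)..π, ∑ m' ∈ Finset.range N,
        (2 / π * c m) * (2 / π * c m') * (Real.cos (((m : ℝ) + 1) * θ) * Real.cos (((m' : ℝ) + 1) * θ)) =
          2 / π * c m ^ 2 := by
      intro m hm
      rw [intervalIntegral.integral_finsetSum fun m' _ => (hterm m m').intervalIntegrable _ _]
      have e2 : ∀ m' ∈ Finset.range N, ∫ θ in (0 : ℝ)..π,
          (2 / π * c m) * (2 / π * c m') * (Real.cos (((m : ℝ) + 1) * θ) * Real.cos (((m' : ℝ) + 1) * θ)) =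
            if m = m' then (2 / π * c m) * (2 / π * c m') * (π / 2) else 0 := by
        intro m' _
        rw [intervalIntegral.integral_const_mul, integral_cos_succ_mul_cos_succ]
        split_ifs <;> simp
      rw [Finset.sum_congr rfl e2, Finset.sum_ite_eq]
      rw [if_pos hm]
      field_simp
    rw [Finset.sum_congr rfl inner, Finset.mul_sum]
  -- (c) `0 ≤ ∫ (f − S)² = ∫ f² − 2∫ fS + ∫ S²`
  have hpos : 0 ≤ ∫ θ in (0 : ℝ)..π, (f θ - S θ) ^ 2 :=
    intervalIntegral.integral_nonneg Real.pi_pos.le fun θ _ => sq_nonneg _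
  have hexp : ∫ θ in (0 : ℝ)..π, (f θ - S θ) ^ 2 =
      (∫ θ in (0 : ℝ)..π, f θ ^ 2) - 2 * (∫ θ in (0 : ℝ)..π, f θ * S θ) + ∫ θ in (0 : ℝ)..π, S θ * S θ := by
    have e : ∀ θ, (f θ - S θ) ^ 2 = (f θ ^ 2 - 2 * (f θ * S θ)) + S θ * S θ := fun θ => by ring
    simp_rw [e]
    rw [intervalIntegral.integral_add (hf2i.sub (hfSi.const_mul 2)) hSSi,
      intervalIntegral.integral_sub hf2i (hfSi.const_mul 2), intervalIntegral.integral_const_mul]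
  rw [hexp, ha, hb'] at hpos
  -- `0 ≤ ∫f² − (2∕π)Σc²`
  have hπ := Real.pi_pos
  have key : 2 / π * ∑ m ∈ Finset.range N, c m ^ 2 ≤ ∫ θ in (0 : ℝ)..π, f θ ^ 2 := by linarith
  calc ∑ m ∈ Finset.range N, c m ^ 2 = π / 2 * (2 / π * ∑ m ∈ Finset.range N, c m ^ 2) := by field_simp
    _ ≤ π / 2 * ∫ θ in (0 : ℝ)..π, f θ ^ 2 := mul_le_mul_of_nonneg_left key (by positivity)

/-- Bessel, summable form: `Σ_m c_m²` converges and is `≤ (π∕2)∫_0^π f² ≤ (π²∕2)M²` for `|f| ≤ M`. [folklore] -/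
theorem summable_sq_cosCoeff {f : ℝ → ℝ} {M : ℝ} (hf : Measurable f) (hb : ∀ θ, |f θ| ≤ M) :
    Summable (fun m : ℕ => (∫ θ in (0 : ℝ)..π, f θ * Real.cos (((m : ℝ) + 1) * θ)) ^ 2) ∧
      ∀ N : ℕ, ∑ m ∈ Finset.range N, (∫ θ in (0 : ℝ)..π, f θ * Real.cos (((m : ℝ) + 1) * θ)) ^ 2 ≤ π ^ 2 / 2 * M ^ 2 := by
  have hint : ∫ θ in (0 : ℝ)..π, f θ ^ 2 ≤ π * M ^ 2 := by
    have h1 : ∫ θ in (0 : ℝ)..π, f θ ^ 2 ≤ ∫ θ in (0 : ℝ)..π, M ^ 2 := by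
      refine intervalIntegral.integral_mono_on Real.pi_pos.le ?_ (by simp) fun θ _ => ?_
      · refine intervalIntegrable_of_bounded (M := M ^ 2) (hf.pow_const 2) (fun θ => ?_) 0 π
        rw [abs_pow]; exact pow_le_pow_left₀ (abs_nonneg _) (hb θ) 2
      · calc f θ ^ 2 = |f θ| ^ 2 := (sq_abs _).symm
          _ ≤ M ^ 2 := pow_le_pow_left₀ (abs_nonneg _) (hb θ) 2
    rw [intervalIntegral.integral_const, smul_eq_mul, sub_zero] at h1
    linarith
  have hbound : ∀ N : ℕ, ∑ m ∈ Finset.range N, (∫ θ in (0 : ℝ)..π, f θ * Real.cos (((m : ℝ) + 1) * θ)) ^ 2 ≤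
      π ^ 2 / 2 * M ^ 2 := fun N =>
    (sum_sq_cosCoeff_le hf hb N).trans (by nlinarith [Real.pi_pos])
  exact ⟨summable_of_sum_range_le (fun m => sq_nonneg _) hbound, hbound⟩

/-! ## §3 The odd cosine series of the triangle wave `arccos ∘ cos` [folklore] -/

/-- The odd cosine series on `[0, π]`: `Σ_i cos((2i+1)u)∕(2i+1)² = π²∕8 − (π∕4)u`. -/
theorem hasSum_odd_cos_div_sq_of_mem {u : ℝ} (hu0 : 0 ≤ u) (huπ : u ≤ π) :
    HasSum (fun i : ℕ => Real.cos ((2 * i + 1) * u) / (2 * i + 1) ^ 2) (π ^ 2 / 8 - π / 4 * u) := by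
  -- `x = u∕(2π) ∈ [0, ½]`, so both `x` and `2x` lie in `[0,1]`
  set x : ℝ := u / (2 * π) with hxdef
  have hx : x ∈ Set.Icc (0 : ℝ) 1 := ⟨by positivity, by
    rw [hxdef, div_le_one (by positivity)]; linarith [Real.pi_pos]⟩
  have h2x : 2 * x ∈ Set.Icc (0 : ℝ) 1 := ⟨by positivity, by
    rw [hxdef, mul_div_assoc', div_le_one (by positivity)]; linarith [Real.pi_pos]⟩
  have hux : ∀ c : ℝ, 2 * π * c * x = c * u := fun c => by
    rw [hxdef]; field_simp
  -- the full series and its even part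
  set f : ℕ → ℝ := fun n => Real.cos (n * u) / (n : ℝ) ^ 2 with hfdef
  have hfull : HasSum f (π ^ 2 * (x ^ 2 - x + 1 / 6)) := by
    have h := Literature.Analysis.Fourier.hasSum_cos_div_sq hx
    simp_rw [hux] at h
    have e : (fun n : ℕ => 1 / (n : ℝ) ^ 2 * Real.cos (n * u)) = f := by
      funext n; simp only [hfdef]; ring
    rw [e] at h
    exact h
  have heven : HasSum (fun k : ℕ => f (2 * k)) ((1 / 4 : ℝ) * (π ^ 2 * ((2 * x) ^ 2 - 2 * x + 1 / 6))) := by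
    have h := (Literature.Analysis.Fourier.hasSum_cos_div_sq h2x).mul_left (1 / 4 : ℝ)
    have e : (fun n : ℕ => (1 / 4 : ℝ) * (1 / (n : ℝ) ^ 2 * Real.cos (2 * π * n * (2 * x)))) = fun k : ℕ => f (2 * k) := by
      funext k
      simp only [hfdef]
      rw [show 2 * π * (k : ℝ) * (2 * x) = 2 * π * (2 * k) * x by ring, hux]
      push_cast
      rcases Nat.eq_zero_or_pos k with hk | hk
      · subst hk; simp
      · have hk' : (k : ℝ) ≠ 0 := by exact_mod_cast hk.ne'
        field_simp
        ring
    rw [e] at h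
    exact h
  -- the odd part: summable as a subseries, value by uniqueness
  have hodd_summable : Summable (fun k : ℕ => f (2 * k + 1)) :=
    hfull.summable.comp_injective (fun a b h => by simpa using h : Function.Injective fun k : ℕ => 2 * k + 1)
  have hsplit := heven.even_add_odd hodd_summable.hasSum
  have hval : ∑' k, f (2 * k + 1) = π ^ 2 / 8 - π / 4 * u := by
    have e := hfull.unique hsplit
    have hu : u = 2 * π * x := by rw [hxdef]; field_simp
    rw [hu]
    linarith
  rw [← hval]
  have e : (fun i : ℕ => Real.cos ((2 * i + 1) * u) / (2 * i + 1) ^ 2) = fun k : ℕ => f (2 * k + 1) := by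
    funext i
    simp only [hfdef]
    push_cast
    ring_nf
  rw [e]
  exact hodd_summable.hasSum

/-- ★ **THE ODD COSINE SERIES OF THE TRIANGLE WAVE.**  For EVERY real `u`:
`Σ_i cos((2i+1)u)∕(2i+1)² = π²∕8 − (π∕4)·arccos(cos u)` (`arccos ∘ cos` is the even `2π`-periodic triangle wave, the distance to `2πℤ`). -/
theorem hasSum_odd_cos_div_sq_arccos_cos (u : ℝ) :
    HasSum (fun i : ℕ => Real.cos ((2 * i + 1) * u) / (2 * i + 1) ^ 2)
      (π ^ 2 / 8 - π / 4 * Real.arccos (Real.cos u)) := by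
  have h := hasSum_odd_cos_div_sq_of_mem (Real.arccos_nonneg (Real.cos u)) (Real.arccos_le_pi (Real.cos u))
  have hcos : Real.cos (Real.arccos (Real.cos u)) = Real.cos u :=
    Real.cos_arccos (Real.neg_one_le_cos u) (Real.cos_le_one u)
  convert h using 2 with i
  -- `cos((2i+1)u) = T_{2i+1}(cos u) = T_{2i+1}(cos u₀) = cos((2i+1)u₀)`
  have e1 := Polynomial.Chebyshev.T_real_cos u ((2 * i + 1 : ℕ) : ℤ)
  have e2 := Polynomial.Chebyshev.T_real_cos (Real.arccos (Real.cos u)) ((2 * i + 1 : ℕ) : ℤ)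
  rw [hcos] at e2
  push_cast at e1 e2
  rw [← e1, e2]

end Summit.QuantumFields.YangMills.Theorems.BalabanUVNodesN19TriangleWaveBessel

end
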